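import Summits.BirchSwinnertonDyer.BirchSwinnertonDyer.Theorems.TeichmullerTwistDescentCellsOfCDT
import HarnessLib

/-!
# Route `TeichmullerTwistDescent`: the support item `ManinSideOfCDT`
# (stmt-BirchSwinnertonDyer-32257) — closed BY NAME

Cell `pub/bsd-wall` (D-0145 line route-BirchSwinnertonDyer-TeichmullerTwistDescent, OPEN rev 9), seat `bsd-line-ttd-p1`
(prover 1/2, g32).

The route planner filed (rev 9) the ledger record of the g31 landing p769544
(`Theorems/TeichmullerTwistDescentCellsOfCDT.lean`): the single cite-only printed fact
`Literature.NumberTheory.Automorphic.CalegariDimitrovTang2025_unboundedDenominators_algInt`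
[Calegari–Dimitrov–Tang 2025, Thm. 1 + Remarks 58–59] implies ALL SEVEN Manin-side declarations of the route —
`PrincipalSeriesOptimalManinUnit` (22638), `SupercuspidalOptimalManinUnitFiveSeven` (22639),
`KummerCornerTorsionOptimalManinUnit` (23883), `SupersingularTorsionOptimalManinUnitFive` (23884),
`KummerCornerWildManinUnit` (24306), `KummerCornerTameManinUnit` (24307),
`OrdinaryLowValuationOptimalManinUnitGeEleven` (23885) — in the conjunction order of `maninSide_of_CDT`.
This file proves that decl VERBATIM, by the landed theorem `maninSide_of_CDT`.

HONESTY.  This closes the SUPPORT item 32257 only (a CONDITIONAL record).  The seven Manin-side items stay OPEN by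
name: each is reached only MODULO the printed Calegari–Dimitrov–Tang theorem, which is cite-only in the tree.  No
Manin theorem is announced; BSD is not proved by this file.
-/

set_option autoImplicit false
-- single-conjunct summit: `Summit.BirchSwinnertonDyer.BirchSwinnertonDyer.…` repeats the name by design
set_option linter.dupNamespace false

namespace Summit.BirchSwinnertonDyer.BirchSwinnertonDyer.Theorems.TeichmullerTwistDescent

/-- **Item stmt-BirchSwinnertonDyer-32257, by name.**  The route decl `ManinSideOfCDT`
(CDT → PSMU ∧ SCMU57 ∧ CORNER ∧ LOW ∧ WILD ∧ TAME ∧ GE11) holds: it is exactly `maninSide_of_CDT`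
(landed p769544).  The seven Manin-side items themselves stay conditional on the printed CDT theorem;
BSD is not proved by this. [cite: CalegariDimitrovTang2025, Thm. 1 and Remarks 58–59] -/
theorem maninSideOfCDT_proof :
    Summit.BirchSwinnertonDyer.BirchSwinnertonDyer.Theses.TeichmullerTwistDescent.ManinSideOfCDT := by
  unfold Summit.BirchSwinnertonDyer.BirchSwinnertonDyer.Theses.TeichmullerTwistDescent.ManinSideOfCDT
  intro hCDT
  exact maninSide_of_CDT hCDT

end Summit.BirchSwinnertonDyer.BirchSwinnertonDyer.Theorems.TeichmullerTwistDescent
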